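import Literature.Probability.RandomPlanarGeometry.HexSAWSurfaceWallRenewalCensusSeven
import Literature.Probability.FitznerVanDerHofstad2017.SawCountKernel
import HarnessLib

/-!
# A counting engine for the wall-renewal census of the adsorbing honeycomb walk: state-carrying search with a
# soundness-and-completeness theorem, `#{ω ∈ ipwb N | visits = V} = #(WCount.census N V)` for every even `N ≥ 1`

Topic `Literature/Probability/RandomPlanarGeometry` (lane «pcv-sawmu», a-p6 g21, car «CENSUS-ENGINE»; parent: a-idea-1 g34's «SEVEN-CENSUS»
(`HexSAWSurfaceWallRenewalCensusSeven`: the pruned list search `WCensus.grow` with a COMPLETENESS theorem, certified against exhibited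
tables by `decide +kernel`)).

WHY.  The order-nine diagonal of the wall-renewal census (classes `(11,2)`, `(12,3)`, `(13,4)` of irreducible positive wall bridges:
`35 541 / 138 149 / 464 878` search nodes) is out of reach of the table-and-certificate pattern (tables ≈ 130 KB per 150 blocks; car 72's
search costs ≈ 10 ms per node in the kernel and exhausts its memory above ≈ 40 000 nodes in one evaluation).  This module replaces it by
ONE symbolic theorem: a search `WCount.grow` whose state carries the current site, a BITMASK of the visited sites (`Nat.testBit`,
kernel-accelerated), the time, the number of surface visits, the running maximum of the abscissa and the list of pending RECORD visits
(a visit `k` with `X_k ≥ X_i` for all `i ≤ k`, not yet followed by an abscissa `≤ X_k` — exactly the candidates for a wall-renewal time), so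
that the final test is `O(1)`, plus a FEASIBILITY cut (the remaining visits must fit into the even times left after walking the depth back:
`23 239 / 54 828 / 103 674` nodes for the three classes above); and a proof that the search is SOUND and COMPLETE, so that the class number
is the number of distinct output lists — no tables, no certificates against tables.  Measured: ≈ 1 ms per search node on the farm.

## What is proved (namespace `…SAW.HexBW.Wall.WCount`; `N`, `V` symbolic throughout)
* §1 the search: `St`, `key`, `site`, `advance`, `ok`, `final`, `child`, `grow`, `init`, `census`.
* §2 unfolding: `mem_child`, `mem_grow_zero`, `mem_grow_succ`, the four `mem_grow_succ_of_*` injections; `funOf` on extended lists;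
  `exists_append_of_mem_grow` (outputs extend the prefix by `r` sites), ★ `nodup_grow` (the search lists are duplicate-free), `toFinset_card_census`.
* §3 SOUNDNESS: the invariant `InvS` (the reversed prefix read as a walk `Census.funOf n l` is a positive half-plane brick-wall self-avoiding
  path and the state describes it: bitmask ⊇ visited sites, visit count, attained running maximum, pending list ⊇ live record visits),
  `invS_init`, ★ `invS_advance`, ★ `grow_sound`, ★★ `funOf_mem_ipwb_of_mem_census`.
* §4 COMPLETENESS: the trajectory `traj N ω` of a genuine irreducible positive wall bridge, its invariant `InvC` (bitmask ⊆ visited sites by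
  `key` injectivity, pending list ⊆ live record visits), the parity/depth lemmas `visits_le_add_div_sub_div`, `visits_add_eq_of_depth` behind
  the feasibility cut, ★ `ok_traj`, ★ `final_traj`, ★★ `revList_mem_census`.
* §5 ★★★ `card_filter_visits_ipwb_eq_census (hN : N % 2 = 0) (h1 : 1 ≤ N) : #((ipwb N).filter (visits N · = V)) = (census N V).toFinset.card`
  and the sanity evaluations `#census (16,1) = 38`, `(18,2) = 34`, `(20,3) = 7` (= car 72's table-certified class numbers; agreement theorem
  `length_census_twenty_three_eq_card_filter`); ★★★ the LENGTH FORM `card_filter_visits_ipwb_eq_length_census` (the census list is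
  duplicate-free: `nodup_grow`, `toFinset_card_census`) — the form the kernel evaluates cheapest.
NOT claimed here: any new census (the order-nine classes are separate cars on this engine).  No budget line (`set_option`) is used: the
whole module elaborates in < 20 s on the farm, the three sanity censuses included.  The three `Nat.beq/ble/blt = decide` bookkeeping lemmas are
imported from the lace build (`FitznerVanDerHofstad2017.SawCountKernel`), not restated.  Label (lane): LANE TOOLING / ENGINE (M), own.
Sources (for the objects only; the engine is ours): [MadrasSlade1993, Section 1.2, Definition 1.2.4; Section 4.2, Definition 4.2.1, (4.2.2)]
(bridges, irreducible bridges, renewal times), [Kesten1963SAW, Section 4] (irreducible bridges), [EntingJensen2009, Section 7.4.2, Fig. 7.10]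
(brickwork form of the honeycomb lattice; finite-lattice enumeration), [BeatonBousquetMelouDeGierDuminilCopinGuttmann2014, Section 3.1] (surface visits).
-/

namespace Literature.Probability.RandomPlanarGeometry.SAW.HexBW.Wall

open Finset Function Census
open Literature.Probability.LatticeModels
open Literature.Probability.FitznerVanDerHofstad2017 (natBeq_eq_decide natBle_eq_decide)

namespace WCount

/-! ### §1  The state-carrying search -/

/-- Search state `(x, d, mask, n, v, mx, pend)`: current site `(X, Y) = (x, −d)`, bitmask of the visited sites, time `n`, surface visits so
far `v`, running maximum `mx` of the abscissa, abscissae `pend` of the record visits not yet followed by an abscissa `≤` theirs.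
[cite: MadrasSlade1993, Section 4.2, Definition 4.2.1] -/
abbrev St : Type := ℕ × ℕ × ℕ × ℕ × ℕ × ℕ × List ℕ

/-- Bit position of the site `(x, −d)` in the visited mask (`B` exceeds every depth `d` met by the search).
[cite: EntingJensen2009, Section 7.4.2, Fig. 7.10] -/
def key (B x d : ℕ) : ℕ := x * B + d

/-- The integer site with abscissa `x` and ordinate `−d`. [cite: EntingJensen2009, Section 7.4.2, Fig. 7.10] -/
def site (x d : ℕ) : ℤ × ℤ := ((x : ℤ), -(d : ℤ))

/-- The state after a move to `(x', −d')` with `r` steps still to go after the move (no validity test): the visit counter increases at an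
even time on the surface, the running maximum is updated, pending record visits with abscissa `≥ x'` are discharged, and an interior
record visit is appended. [cite: MadrasSlade1993, Section 4.2, Definition 4.2.1] -/
def advance (B r x' d' : ℕ) (s : St) : St :=
  match s with
  | (_, _, mask, n, v, mx, pend) =>
    (x', d', mask ||| 2 ^ key B x' d', n + 1,
      (bif Nat.beq ((n + 1) % 2) 0 && Nat.beq d' 0 then v + 1 else v),
      (bif Nat.ble mx x' then x' else mx),
      (bif Nat.beq ((n + 1) % 2) 0 && Nat.beq d' 0 && Nat.ble mx x' && !(Nat.beq r 0) then
          pend.filter (fun p => Nat.blt p x') ++ [x']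
        else pend.filter (fun p => Nat.blt p x')))

/-- Validity of a move to `(x', −d')` (time `n + 1`) with `r` steps to go after it: positive abscissa, depth at most `r`, an unvisited site,
the visit budget (at most `V − 1` visits strictly before the end, `V` at the end), and FEASIBILITY of the remaining visits (they occur at even
times `≥ n + 1 + max(d', 1)`, of which there are `(n + 1 + r)/2 − (n + max(d', 1))/2` up to the end).
[cite: MadrasSlade1993, Section 1.2, Definition 1.2.4; Section 4.2, Definition 4.2.1] -/
def ok (V B r x' d' : ℕ) (s : St) : Bool :=
  match s with
  | (_, _, mask, n, v, _, _) =>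
    Nat.ble 1 x' && Nat.ble d' r && !(Nat.testBit mask (key B x' d')) &&
      Nat.ble ((bif Nat.beq ((n + 1) % 2) 0 && Nat.beq d' 0 then v + 1 else v) + (bif Nat.beq r 0 then 0 else 1)) V &&
      Nat.ble (V - (bif Nat.beq ((n + 1) % 2) 0 && Nat.beq d' 0 then v + 1 else v)) ((n + 1 + r) / 2 - (n + max d' 1) / 2)

/-- The final test at time `N`: exactly `V` visits, maximal final abscissa, no pending record visit.
[cite: MadrasSlade1993, Section 4.2, Definition 4.2.1] -/
def final (V : ℕ) (s : St) : Bool :=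
  match s with
  | (x, _, _, _, v, mx, pend) => Nat.beq v V && Nat.beq mx x && pend.isEmpty

/-- One child of the search: the completions through the move to `(x', −d')`, if the move is valid.
[cite: MadrasSlade1993, Section 4.2, Definition 4.2.1] -/
def child (V B r x' d' : ℕ) (s : St) (l : List (ℤ × ℤ)) (k : St → List (ℤ × ℤ) → List (List (ℤ × ℤ))) :
    List (List (ℤ × ℤ)) :=
  bif ok V B r x' d' s then k (advance B r x' d' s) (site x' d' :: l) else []

/-- **The search**: all completions, as reversed integer site lists, of the reversed prefix `l` in state `s` with `r` steps to go; the
three brick-wall neighbours are tried in the order right, left, vertical. [cite: MadrasSlade1993, Section 4.2, Definition 4.2.1] -/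
def grow (V B : ℕ) : ℕ → St → List (ℤ × ℤ) → List (List (ℤ × ℤ))
  | 0, s, l => bif final V s then [l] else []
  | r + 1, s, l =>
    match s with
    | (x, d, _, _, _, _, _) =>
      child V B r (x + 1) d s l (fun s' l' => grow V B r s' l') ++
      child V B r (x - 1) d s l (fun s' l' => grow V B r s' l') ++
      (bif Nat.beq ((x + d) % 2) 0 then
        (bif Nat.ble 1 d then child V B r x (d - 1) s l (fun s' l' => grow V B r s' l') else [])
       else child V B r x (d + 1) s l (fun s' l' => grow V B r s' l'))

/-- The initial state (at the origin, time `0`). [cite: MadrasSlade1993, Section 1.1] -/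
def init (B : ℕ) : St := (0, 0, 2 ^ key B 0 0, 0, 0, 0, [])

/-- **The census list** of the irreducible positive wall bridges of length `N` with `V` surface visits, as reversed integer site lists.
[cite: MadrasSlade1993, Section 4.2, Definition 4.2.1, (4.2.2)] -/
def census (N V : ℕ) : List (List (ℤ × ℤ)) := grow V (N + 1) N (init (N + 1)) [(0, 0)]

/-! ### §2  Unfolding the search; table-free walks `Census.funOf` on extended lists -/

variable {V B N : ℕ}

/-- Membership in a child. [cite: MadrasSlade1993, Section 4.2, Definition 4.2.1] -/
theorem mem_child {r x' d' : ℕ} {s : St} {l y : List (ℤ × ℤ)} {k : St → List (ℤ × ℤ) → List (List (ℤ × ℤ))} :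
    y ∈ child V B r x' d' s l k ↔ ok V B r x' d' s = true ∧ y ∈ k (advance B r x' d' s) (site x' d' :: l) := by
  unfold child
  cases ok V B r x' d' s <;> simp

/-- Membership at a leaf. [cite: MadrasSlade1993, Section 4.2, Definition 4.2.1] -/
theorem mem_grow_zero {s : St} {l y : List (ℤ × ℤ)} : y ∈ grow V B 0 s l ↔ final V s = true ∧ y = l := by
  rw [grow]
  cases final V s <;> simp

/-- Membership one level down: through one of the (at most three) valid moves. [cite: MadrasSlade1993, Section 4.2, Definition 4.2.1] -/
theorem mem_grow_succ {r x d mask n v mx : ℕ} {pend : List ℕ} {l y : List (ℤ × ℤ)}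
    (h : y ∈ grow V B (r + 1) (x, d, mask, n, v, mx, pend) l) :
    ∃ x' d', ((x' = x + 1 ∧ d' = d) ∨ (x' = x - 1 ∧ d' = d) ∨ (x' = x ∧ d' + 1 = d ∧ (x + d) % 2 = 0) ∨
        (x' = x ∧ d' = d + 1 ∧ (x + d) % 2 = 1)) ∧
      ok V B r x' d' (x, d, mask, n, v, mx, pend) = true ∧
      y ∈ grow V B r (advance B r x' d' (x, d, mask, n, v, mx, pend)) (site x' d' :: l) := by
  rw [grow] at h
  simp only [List.mem_append] at h
  rcases h with (h | h) | h
  · obtain ⟨hok, hy⟩ := mem_child.1 h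
    exact ⟨x + 1, d, Or.inl ⟨rfl, rfl⟩, hok, hy⟩
  · obtain ⟨hok, hy⟩ := mem_child.1 h
    exact ⟨x - 1, d, Or.inr (Or.inl ⟨rfl, rfl⟩), hok, hy⟩
  · revert h
    cases hpar : Nat.beq ((x + d) % 2) 0 <;> intro h
    · rw [cond_false] at h
      obtain ⟨hok, hy⟩ := mem_child.1 h
      have hp : (x + d) % 2 = 1 := by have := Nat.ne_of_beq_eq_false hpar; omega
      exact ⟨x, d + 1, Or.inr (Or.inr (Or.inr ⟨rfl, rfl, hp⟩)), hok, hy⟩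
    · rw [cond_true] at h
      have hp : (x + d) % 2 = 0 := Nat.eq_of_beq_eq_true hpar
      revert h
      cases hd : Nat.ble 1 d <;> intro h
      · rw [cond_false] at h; simp at h
      · rw [cond_true] at h
        obtain ⟨hok, hy⟩ := mem_child.1 h
        have h1 : 1 ≤ d := Nat.le_of_ble_eq_true hd
        exact ⟨x, d - 1, Or.inr (Or.inr (Or.inl ⟨rfl, by omega, hp⟩)), hok, hy⟩

/-- The right move's completions are completions. [cite: MadrasSlade1993, Section 4.2, Definition 4.2.1] -/
theorem mem_grow_succ_of_right {r x d mask n v mx : ℕ} {pend : List ℕ} {l y : List (ℤ × ℤ)}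
    (hok : ok V B r (x + 1) d (x, d, mask, n, v, mx, pend) = true)
    (hy : y ∈ grow V B r (advance B r (x + 1) d (x, d, mask, n, v, mx, pend)) (site (x + 1) d :: l)) :
    y ∈ grow V B (r + 1) (x, d, mask, n, v, mx, pend) l := by
  rw [grow]
  simp only [List.mem_append]
  exact Or.inl (Or.inl (mem_child.2 ⟨hok, hy⟩))

/-- The left move's completions are completions. [cite: MadrasSlade1993, Section 4.2, Definition 4.2.1] -/
theorem mem_grow_succ_of_left {r x d mask n v mx : ℕ} {pend : List ℕ} {l y : List (ℤ × ℤ)}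
    (hok : ok V B r (x - 1) d (x, d, mask, n, v, mx, pend) = true)
    (hy : y ∈ grow V B r (advance B r (x - 1) d (x, d, mask, n, v, mx, pend)) (site (x - 1) d :: l)) :
    y ∈ grow V B (r + 1) (x, d, mask, n, v, mx, pend) l := by
  rw [grow]
  simp only [List.mem_append]
  exact Or.inl (Or.inr (mem_child.2 ⟨hok, hy⟩))

/-- The upward move's completions are completions. [cite: MadrasSlade1993, Section 4.2, Definition 4.2.1] -/
theorem mem_grow_succ_of_up {r x d mask n v mx : ℕ} {pend : List ℕ} {l y : List (ℤ × ℤ)} (hpar : (x + d) % 2 = 0) (hd : 1 ≤ d)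
    (hok : ok V B r x (d - 1) (x, d, mask, n, v, mx, pend) = true)
    (hy : y ∈ grow V B r (advance B r x (d - 1) (x, d, mask, n, v, mx, pend)) (site x (d - 1) :: l)) :
    y ∈ grow V B (r + 1) (x, d, mask, n, v, mx, pend) l := by
  rw [grow]
  simp only [List.mem_append]
  refine Or.inr ?_
  rw [show Nat.beq ((x + d) % 2) 0 = true from (natBeq_eq_decide _ _).trans (decide_eq_true hpar), cond_true,
    show Nat.ble 1 d = true from Nat.ble_eq_true_of_le hd, cond_true]
  exact mem_child.2 ⟨hok, hy⟩

/-- The downward move's completions are completions. [cite: MadrasSlade1993, Section 4.2, Definition 4.2.1] -/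
theorem mem_grow_succ_of_down {r x d mask n v mx : ℕ} {pend : List ℕ} {l y : List (ℤ × ℤ)} (hpar : (x + d) % 2 = 1)
    (hok : ok V B r x (d + 1) (x, d, mask, n, v, mx, pend) = true)
    (hy : y ∈ grow V B r (advance B r x (d + 1) (x, d, mask, n, v, mx, pend)) (site x (d + 1) :: l)) :
    y ∈ grow V B (r + 1) (x, d, mask, n, v, mx, pend) l := by
  rw [grow]
  simp only [List.mem_append]
  refine Or.inr ?_
  have hne : Nat.beq ((x + d) % 2) 0 = false := (natBeq_eq_decide _ _).trans (decide_eq_false (by omega))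
  rw [hne, cond_false]
  exact mem_child.2 ⟨hok, hy⟩

/-- Unfolding the validity test. [cite: MadrasSlade1993, Section 4.2, Definition 4.2.1] -/
theorem ok_iff {r x' d' x d mask n v mx : ℕ} {pend : List ℕ} :
    ok V B r x' d' (x, d, mask, n, v, mx, pend) = true ↔
      1 ≤ x' ∧ d' ≤ r ∧ Nat.testBit mask (key B x' d') = false ∧
        (v + (if (n + 1) % 2 = 0 ∧ d' = 0 then 1 else 0)) + (if r = 0 then 0 else 1) ≤ V ∧
        V - (v + (if (n + 1) % 2 = 0 ∧ d' = 0 then 1 else 0)) ≤ (n + 1 + r) / 2 - (n + max d' 1) / 2 := by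
  have e1 : (bif Nat.beq ((n + 1) % 2) 0 && Nat.beq d' 0 then v + 1 else v) =
      v + (if (n + 1) % 2 = 0 ∧ d' = 0 then 1 else 0) := by
    simp only [natBeq_eq_decide]
    by_cases h1 : (n + 1) % 2 = 0 <;> by_cases h2 : d' = 0 <;> simp [h1, h2]
  have e2 : (bif Nat.beq r 0 then 0 else 1) = (if r = 0 then 0 else 1 : ℕ) := by
    simp only [natBeq_eq_decide]
    by_cases h : r = 0 <;> simp [h]
  simp only [ok, Bool.and_eq_true, Nat.ble_eq, Bool.not_eq_true', e1, e2]
  tauto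

/-- Unfolding the final test. [cite: MadrasSlade1993, Section 4.2, Definition 4.2.1] -/
theorem final_iff {x d mask n v mx : ℕ} {pend : List ℕ} :
    final V (x, d, mask, n, v, mx, pend) = true ↔ v = V ∧ mx = x ∧ pend = [] := by
  simp only [final, Bool.and_eq_true, Nat.beq_eq, List.isEmpty_iff]
  tauto

/-- The components of `advance`. [cite: MadrasSlade1993, Section 4.2, Definition 4.2.1] -/
theorem advance_eq {r x' d' x d mask n v mx : ℕ} {pend : List ℕ} :
    advance B r x' d' (x, d, mask, n, v, mx, pend) =
      (x', d', mask ||| 2 ^ key B x' d', n + 1, v + (if (n + 1) % 2 = 0 ∧ d' = 0 then 1 else 0), max mx x',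
        (if (n + 1) % 2 = 0 ∧ d' = 0 ∧ mx ≤ x' ∧ r ≠ 0 then pend.filter (fun p => Nat.blt p x') ++ [x']
         else pend.filter (fun p => Nat.blt p x'))) := by
  have e1 : (bif Nat.beq ((n + 1) % 2) 0 && Nat.beq d' 0 then v + 1 else v) =
      v + (if (n + 1) % 2 = 0 ∧ d' = 0 then 1 else 0) := by
    simp only [natBeq_eq_decide]
    by_cases h1 : (n + 1) % 2 = 0 <;> by_cases h2 : d' = 0 <;> simp [h1, h2]
  have e2 : (bif Nat.ble mx x' then x' else mx) = max mx x' := by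
    simp only [natBle_eq_decide]
    by_cases h : mx ≤ x'
    · simp [h]
    · simp [h, max_eq_left (le_of_not_ge h)]
  have e3 : (bif Nat.beq ((n + 1) % 2) 0 && Nat.beq d' 0 && Nat.ble mx x' && !(Nat.beq r 0) then
        pend.filter (fun p => Nat.blt p x') ++ [x'] else pend.filter (fun p => Nat.blt p x')) =
      (if (n + 1) % 2 = 0 ∧ d' = 0 ∧ mx ≤ x' ∧ r ≠ 0 then pend.filter (fun p => Nat.blt p x') ++ [x']
         else pend.filter (fun p => Nat.blt p x')) := by
    simp only [natBeq_eq_decide, natBle_eq_decide]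
    by_cases h1 : (n + 1) % 2 = 0 <;> by_cases h2 : d' = 0 <;> by_cases h3 : mx ≤ x' <;> by_cases h4 : r = 0 <;>
      simp [h1, h2, h3, h4]
  simp only [advance, e1, e2, e3]

/-- Membership in the filtered pending list. [cite: MadrasSlade1993, Section 4.2, Definition 4.2.1] -/
theorem mem_filter_blt {pend : List ℕ} {x' p : ℕ} : p ∈ pend.filter (fun q => Nat.blt q x') ↔ p ∈ pend ∧ p < x' := by
  rw [List.mem_filter, Nat.blt_eq]

/-- A table-free walk keeps its values when the list is extended at the front (later time). [cite: MadrasSlade1993, Section 1.1] -/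
theorem funOf_cons_of_le {n : ℕ} {l : List (ℤ × ℤ)} (q : ℤ × ℤ) {i : ℕ} (hi : i ≤ n) :
    funOf (n + 1) (q :: l) i = funOf n l i := by
  simp only [funOf, min_eq_left hi, min_eq_left (hi.trans (Nat.le_succ n)), show n + 1 - i = (n - i) + 1 by omega,
    List.getD_cons_succ]

/-- The new value of an extended table-free walk. [cite: MadrasSlade1993, Section 1.1] -/
theorem funOf_cons_self {n : ℕ} {l : List (ℤ × ℤ)} (q : ℤ × ℤ) : funOf (n + 1) (q :: l) (n + 1) = toSite q := by
  simp only [funOf, min_self, Nat.sub_self, List.getD_cons_zero]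

/-- A table-free walk is frozen after its length. [cite: MadrasSlade1993, Section 1.1] -/
theorem funOf_of_le {n : ℕ} {l : List (ℤ × ℤ)} {i : ℕ} (hi : n ≤ i) : funOf n l i = funOf n l n := by
  simp only [funOf, min_eq_right hi, min_self]

/-- Coordinates of `toSite (site x d)`. [cite: EntingJensen2009, Section 7.4.2, Fig. 7.10] -/
theorem toSite_site_apply_zero (x d : ℕ) : toSite (site x d) 0 = (x : ℤ) := by simp [toSite, site]

/-- Coordinates of `toSite (site x d)`. [cite: EntingJensen2009, Section 7.4.2, Fig. 7.10] -/
theorem toSite_site_apply_one (x d : ℕ) : toSite (site x d) 1 = -(d : ℤ) := by simp [toSite, site]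

/-- The key of a site with nonnegative abscissa `a` and nonpositive ordinate `b`, from integer coordinates.
[cite: EntingJensen2009, Section 7.4.2, Fig. 7.10] -/
theorem key_toNat_eq {a b : ℤ} {x d : ℕ} (ha : (x : ℤ) = a) (hb : (d : ℤ) = -b) : key B a.toNat (-b).toNat = key B x d := by
  subst ha; rw [← hb]; simp

/-- `key B` is injective on depths `< B`. [cite: EntingJensen2009, Section 7.4.2, Fig. 7.10] -/
theorem key_inj {x d x' d' : ℕ} (hd : d < B) (hd' : d' < B) (h : key B x d = key B x' d') : x = x' ∧ d = d' := by
  unfold key at h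
  have h1 := Nat.add_mul_div_left d x (by omega : 0 < B)
  have h2 := Nat.add_mul_div_left d' x' (by omega : 0 < B)
  rw [Nat.div_eq_of_lt hd, Nat.zero_add] at h1
  rw [Nat.div_eq_of_lt hd', Nat.zero_add] at h2
  have e : (d + B * x) / B = (d' + B * x') / B := by rw [Nat.add_comm, Nat.mul_comm, h, Nat.mul_comm, Nat.add_comm]
  rw [h1, h2] at e
  subst e
  constructor
  · rfl
  · omega

/-- `site` is injective. [cite: EntingJensen2009, Section 7.4.2, Fig. 7.10] -/
theorem site_inj {x d x' d' : ℕ} (h : site x d = site x' d') : x = x' ∧ d = d' := by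
  simp only [site, Prod.mk.injEq, neg_inj, Nat.cast_inj] at h
  exact h

/-- Every output list of the search extends the given reversed prefix by exactly `r` new sites in front.
[cite: MadrasSlade1993, Section 4.2, Definition 4.2.1] -/
theorem exists_append_of_mem_grow : ∀ (r : ℕ) (s : St) (l y : List (ℤ × ℤ)), y ∈ grow V B r s l → ∃ m, y = m ++ l ∧ m.length = r
  | 0, s, l, y, hy => ⟨[], by rw [(mem_grow_zero.1 hy).2, List.nil_append], rfl⟩
  | r + 1, (x, d, mask, n, v, mx, pend), l, y, hy => by
    obtain ⟨x', d', -, -, hy'⟩ := mem_grow_succ hy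
    obtain ⟨m, hm, hlen⟩ := exists_append_of_mem_grow r _ _ y hy'
    exact ⟨m ++ [site x' d'], by rw [hm, List.append_assoc, List.singleton_append], by simp [hlen]⟩

/-- Output lists through different first moves are different. [cite: MadrasSlade1993, Section 4.2, Definition 4.2.1] -/
theorem ne_of_mem_child {r x₁ d₁ x₂ d₂ : ℕ} {s : St} {l : List (ℤ × ℤ)} (hne : (x₁, d₁) ≠ (x₂, d₂)) :
    ∀ a ∈ (child V B r x₁ d₁ s l fun s' l' => grow V B r s' l'), ∀ b ∈ (child V B r x₂ d₂ s l fun s' l' => grow V B r s' l'), a ≠ b := by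
  intro a h₁ b h₂ hab
  subst hab
  obtain ⟨-, h₁⟩ := mem_child.1 h₁
  obtain ⟨-, h₂⟩ := mem_child.1 h₂
  obtain ⟨m₁, e₁, hl₁⟩ := exists_append_of_mem_grow r _ _ a h₁
  obtain ⟨m₂, e₂, hl₂⟩ := exists_append_of_mem_grow r _ _ a h₂
  rw [e₁] at e₂
  have h := (List.append_inj e₂ (by rw [hl₁, hl₂])).2
  obtain ⟨ex, ed⟩ := site_inj (List.cons.inj h).1
  exact hne (by rw [ex, ed])

/-- A child list is duplicate-free if the searches one level down are. [cite: MadrasSlade1993, Section 4.2, Definition 4.2.1] -/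
theorem nodup_child {r x' d' : ℕ} {s : St} {l : List (ℤ × ℤ)} (ih : ∀ (s' : St) (l' : List (ℤ × ℤ)), (grow V B r s' l').Nodup) :
    (child V B r x' d' s l fun s' l' => grow V B r s' l').Nodup := by
  unfold child
  cases ok V B r x' d' s
  · exact List.nodup_nil
  · exact ih _ _

/-- ★ **The search lists are duplicate-free** (different branches extend the prefix by different sites).
[cite: MadrasSlade1993, Section 4.2, Definition 4.2.1] -/
theorem nodup_grow : ∀ (r : ℕ) (s : St) (l : List (ℤ × ℤ)), (grow V B r s l).Nodup
  | 0, s, l => by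
    rw [grow]
    cases final V s
    · exact List.nodup_nil
    · exact List.nodup_singleton l
  | r + 1, (x, d, mask, n, v, mx, pend), l => by
    have ih : ∀ (s' : St) (l' : List (ℤ × ℤ)), (grow V B r s' l').Nodup := fun s' l' => nodup_grow r s' l'
    have h12 : (x + 1, d) ≠ (x - 1, d) := fun h => by have := (Prod.mk.inj h).1; omega
    have h13 : (x + 1, d) ≠ (x, d - 1) := fun h => by have := (Prod.mk.inj h).1; omega
    have h23 : 1 ≤ d → (x - 1, d) ≠ (x, d - 1) := fun hd h => by have := (Prod.mk.inj h).2; omega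
    have h14 : (x + 1, d) ≠ (x, d + 1) := fun h => by have := (Prod.mk.inj h).1; omega
    have h24 : (x - 1, d) ≠ (x, d + 1) := fun h => by have := (Prod.mk.inj h).2; omega
    rw [grow]
    cases hpar : Nat.beq ((x + d) % 2) 0
    · simp only [cond_false]
      refine List.nodup_append.2 ⟨List.nodup_append.2 ⟨nodup_child ih, nodup_child ih, ne_of_mem_child h12⟩, nodup_child ih,
        fun a ha b hb => ?_⟩
      rcases List.mem_append.1 ha with ha | ha
      · exact ne_of_mem_child h14 a ha b hb
      · exact ne_of_mem_child h24 a ha b hb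
    · simp only [cond_true]
      cases hd : Nat.ble 1 d
      · simp only [cond_false, List.append_nil]
        exact List.nodup_append.2 ⟨nodup_child ih, nodup_child ih, ne_of_mem_child h12⟩
      · simp only [cond_true]
        have h1 : 1 ≤ d := Nat.le_of_ble_eq_true hd
        refine List.nodup_append.2 ⟨List.nodup_append.2 ⟨nodup_child ih, nodup_child ih, ne_of_mem_child h12⟩, nodup_child ih,
          fun a ha b hb => ?_⟩
        rcases List.mem_append.1 ha with ha | ha
        · exact ne_of_mem_child h13 a ha b hb
        · exact ne_of_mem_child (h23 h1) a ha b hb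

/-- ★ The census list is duplicate-free, so its number of DISTINCT lists is its length. [cite: MadrasSlade1993, Section 4.2, Definition 4.2.1, (4.2.2)] -/
theorem toFinset_card_census (N V : ℕ) : (census N V).toFinset.card = (census N V).length :=
  List.toFinset_card_of_nodup (nodup_grow N _ _)

/-! ### §3  Soundness: every output list is an irreducible positive wall bridge with `V` visits -/

/-- The soundness invariant of a state `s` and a reversed prefix `l` of length `n + 1`, read as the walk `ω = Census.funOf n l`:
a positive half-plane brick-wall self-avoiding path from the origin, and the state holds its endpoint, a bitmask containing its sites,
its time, its visit count, its (attained) running maximum, and a pending list containing every live record visit.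
[cite: MadrasSlade1993, Section 1.2, Definition 1.2.4; Section 4.2, Definition 4.2.1] -/
structure InvS (N B n : ℕ) (s : St) (l : List (ℤ × ℤ)) : Prop where
  /-- length [cite: MadrasSlade1993, Section 4.2, Definition 4.2.1] -/
  len : l.length = n + 1
  /-- start at the origin [cite: MadrasSlade1993, Section 4.2, Definition 4.2.1] -/
  zero : funOf n l 0 = 0
  /-- brick-wall steps [cite: MadrasSlade1993, Section 4.2, Definition 4.2.1] -/
  bw : IsBW n (funOf n l)
  /-- self-avoiding [cite: MadrasSlade1993, Section 4.2, Definition 4.2.1] -/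
  inj : Set.InjOn (funOf n l) {i | i ≤ n}
  /-- positive abscissae after time `0` [cite: MadrasSlade1993, Section 4.2, Definition 4.2.1] -/
  pos : ∀ i, 1 ≤ i → i ≤ n → 1 ≤ funOf n l i 0
  /-- lower half plane [cite: MadrasSlade1993, Section 4.2, Definition 4.2.1] -/
  hp : ∀ i, i ≤ n → funOf n l i 1 ≤ 0
  /-- the time component [cite: MadrasSlade1993, Section 4.2, Definition 4.2.1] -/
  time : s.2.2.2.1 = n
  /-- the abscissa component [cite: MadrasSlade1993, Section 4.2, Definition 4.2.1] -/
  hx : (s.1 : ℤ) = funOf n l n 0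
  /-- the depth component [cite: MadrasSlade1993, Section 4.2, Definition 4.2.1] -/
  hd : (s.2.1 : ℤ) = -funOf n l n 1
  /-- the depth is at most the number of steps to go [cite: MadrasSlade1993, Section 4.2, Definition 4.2.1] -/
  dle : s.2.1 ≤ N - n
  /-- the bitmask contains every visited site [cite: MadrasSlade1993, Section 4.2, Definition 4.2.1] -/
  mask : ∀ i, i ≤ n → Nat.testBit s.2.2.1 (key B (funOf n l i 0).toNat (-funOf n l i 1).toNat) = true
  /-- the visit counter [cite: MadrasSlade1993, Section 4.2, Definition 4.2.1] -/
  vis : s.2.2.2.2.1 = visits n (funOf n l)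
  /-- the running maximum bounds the abscissae [cite: MadrasSlade1993, Section 4.2, Definition 4.2.1] -/
  mxle : ∀ i, i ≤ n → funOf n l i 0 ≤ (s.2.2.2.2.2.1 : ℤ)
  /-- the running maximum is attained [cite: MadrasSlade1993, Section 4.2, Definition 4.2.1] -/
  mxat : ∃ i, i ≤ n ∧ (s.2.2.2.2.2.1 : ℤ) = funOf n l i 0
  /-- every live record visit is pending [cite: MadrasSlade1993, Section 4.2, Definition 4.2.1] -/
  pend : ∀ k, 1 ≤ k → k ≤ n → k < N → k % 2 = 0 → funOf n l k 1 = 0 → (∀ i, i ≤ k → funOf n l i 0 ≤ funOf n l k 0) →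
    (∀ j, k < j → j ≤ n → funOf n l k 0 < funOf n l j 0) → (funOf n l k 0).toNat ∈ s.2.2.2.2.2.2

/-- The initial state satisfies the invariant. [cite: MadrasSlade1993, Section 1.1] -/
theorem invS_init (N B : ℕ) : InvS N B 0 (init B) [(0, 0)] where
  len := rfl
  zero := by simp [funOf, toSite_zero]
  bw := fun i hi => absurd hi (Nat.not_lt_zero i)
  inj := fun i hi j hj _ => by simp only [Set.mem_setOf_eq, Nat.le_zero] at hi hj; rw [hi, hj]
  pos := fun i h1 h0 => by omega
  hp := fun i hi => by rw [Nat.le_zero.1 hi]; simp [funOf, toSite]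
  time := rfl
  hx := by simp [init, funOf, toSite]
  hd := by simp [init, funOf, toSite]
  dle := Nat.zero_le _
  mask := fun i hi => by
    rw [Nat.le_zero.1 hi]
    simp [init, funOf, toSite, Nat.testBit_two_pow_self]
  vis := rfl
  mxle := fun i hi => by rw [Nat.le_zero.1 hi]; simp [init, funOf, toSite]
  mxat := ⟨0, le_rfl, by simp [init, funOf, toSite]⟩
  pend := fun k h1 h0 => by omega

/-- ★ **The invariant survives a valid move along a brick-wall edge.** [cite: MadrasSlade1993, Section 1.2, Definition 1.2.4; Section 4.2, Definition 4.2.1] -/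
theorem invS_advance {n r x' d' x d mask nn v mx : ℕ} {pend : List ℕ} {l : List (ℤ × ℤ)}
    (hI : InvS N B n (x, d, mask, nn, v, mx, pend) l) (hN : n + 1 + r = N)
    (hcand : (x' = x + 1 ∧ d' = d) ∨ (x' = x - 1 ∧ d' = d) ∨ (x' = x ∧ d' + 1 = d ∧ (x + d) % 2 = 0) ∨
      (x' = x ∧ d' = d + 1 ∧ (x + d) % 2 = 1))
    (hok : ok V B r x' d' (x, d, mask, nn, v, mx, pend) = true) :
    InvS N B (n + 1) (advance B r x' d' (x, d, mask, nn, v, mx, pend)) (site x' d' :: l) := by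
  obtain ⟨hlen, hzero, hbw, hinj, hpos, hhp, htime, hx, hd, hdle, hmask, hvis, hmxle, hmxat, hpend⟩ := hI
  simp only at htime hx hd hdle hmask hvis hmxle hmxat hpend
  obtain ⟨h1x', hd'r, hbit, -, -⟩ := ok_iff.1 hok
  rw [advance_eq]
  -- the extended walk
  have hle : ∀ {i}, i ≤ n → funOf (n + 1) (site x' d' :: l) i = funOf n l i := fun hi => funOf_cons_of_le _ hi
  have hnew0 : funOf (n + 1) (site x' d' :: l) (n + 1) 0 = (x' : ℤ) := by rw [funOf_cons_self, toSite_site_apply_zero]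
  have hnew1 : funOf (n + 1) (site x' d' :: l) (n + 1) 1 = -(d' : ℤ) := by rw [funOf_cons_self, toSite_site_apply_one]
  -- the new site is not an old one
  have hfresh : ∀ i, i ≤ n → funOf n l i ≠ funOf (n + 1) (site x' d' :: l) (n + 1) := by
    intro i hi he
    have hm := hmask i hi
    have e0 : funOf n l i 0 = (x' : ℤ) := by rw [he, hnew0]
    have e1 : funOf n l i 1 = -(d' : ℤ) := by rw [he, hnew1]
    rw [key_toNat_eq e0.symm (by rw [e1, neg_neg])] at hm
    rw [hm] at hbit
    exact Bool.noConfusion hbit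
  refine
    { len := by rw [List.length_cons, hlen]
      zero := by rw [hle (Nat.zero_le n), hzero]
      bw := ?_
      inj := ?_
      pos := ?_
      hp := ?_
      time := by simp [htime]
      hx := by simp [hnew0]
      hd := by simp [hnew1]
      dle := by show d' ≤ N - (n + 1); omega
      mask := ?_
      vis := ?_
      mxle := ?_
      mxat := ?_
      pend := ?_ }
  · -- brick-wall steps
    intro i hi
    rcases Nat.lt_succ_iff_lt_or_eq.1 hi with hi | rfl
    · rw [hle hi.le, hle (Nat.succ_le_of_lt hi)]; exact hbw i hi
    · have hX : funOf i l i 0 = (x : ℤ) := hx.symm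
      have hY : funOf i l i 1 = -(d : ℤ) := by omega
      rw [hle le_rfl, brickWallGraph_adj_coord, hnew0, hnew1, hX, hY]
      rcases hcand with ⟨rfl, rfl⟩ | ⟨rfl, rfl⟩ | ⟨rfl, hdd, hpar⟩ | ⟨rfl, rfl, hpar⟩
      · left; constructor
        · left; push_cast; ring
        · rfl
      · left; constructor
        · right; push_cast [show 1 ≤ x by omega]; ring
        · rfl
      · right
        refine ⟨rfl, Or.inl ⟨by omega, by omega⟩⟩
      · right
        refine ⟨rfl, Or.inr ⟨by push_cast; ring, by push_cast; omega⟩⟩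
  · -- self-avoiding
    intro i hi j hj hij
    simp only [Set.mem_setOf_eq] at hi hj
    rcases Nat.lt_succ_iff_lt_or_eq.1 (Nat.lt_succ_iff.2 hi) with hi' | rfl <;>
      rcases Nat.lt_succ_iff_lt_or_eq.1 (Nat.lt_succ_iff.2 hj) with hj' | rfl
    · rw [hle (Nat.lt_succ_iff.1 hi'), hle (Nat.lt_succ_iff.1 hj')] at hij
      exact hinj (show i ∈ {i | i ≤ n} by simpa [Nat.lt_succ_iff] using hi')
        (show j ∈ {i | i ≤ n} by simpa [Nat.lt_succ_iff] using hj') hij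
    · rw [hle (Nat.lt_succ_iff.1 hi')] at hij
      exact absurd hij (hfresh i (Nat.lt_succ_iff.1 hi'))
    · rw [hle (Nat.lt_succ_iff.1 hj')] at hij
      exact absurd hij.symm (hfresh j (Nat.lt_succ_iff.1 hj'))
    · rfl
  · -- positive
    intro i h1 hi
    rcases Nat.lt_succ_iff_lt_or_eq.1 (Nat.lt_succ_iff.2 hi) with hi' | rfl
    · rw [hle (Nat.lt_succ_iff.1 hi')]; exact hpos i h1 (Nat.lt_succ_iff.1 hi')
    · rw [hnew0]; exact_mod_cast h1x'
  · -- half plane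
    intro i hi
    rcases Nat.lt_succ_iff_lt_or_eq.1 (Nat.lt_succ_iff.2 hi) with hi' | rfl
    · rw [hle (Nat.lt_succ_iff.1 hi')]; exact hhp i (Nat.lt_succ_iff.1 hi')
    · rw [hnew1]; omega
  · -- bitmask
    intro i hi
    show Nat.testBit (mask ||| 2 ^ key B x' d') _ = true
    rw [Nat.testBit_lor]
    rcases Nat.lt_succ_iff_lt_or_eq.1 (Nat.lt_succ_iff.2 hi) with hi' | rfl
    · rw [hle (Nat.lt_succ_iff.1 hi'), hmask i (Nat.lt_succ_iff.1 hi'), Bool.true_or]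
    · rw [hnew0, hnew1, neg_neg, Int.toNat_natCast, Int.toNat_natCast, Nat.testBit_two_pow_self, Bool.or_true]
  · -- visits
    show v + _ = visits (n + 1) _
    rw [visits_succ, visits_congr (ξ := funOf n l) (fun i _ hi => by rw [hle hi]), ← hvis, hnew1, htime]
    congr 1
    by_cases h0 : d' = 0
    · simp [h0]
    · rw [if_neg (fun h => h0 h.2), if_neg (fun h => h0 (by omega))]
  · -- running maximum bounds
    intro i hi
    show _ ≤ ((max mx x' : ℕ) : ℤ)
    rcases Nat.lt_succ_iff_lt_or_eq.1 (Nat.lt_succ_iff.2 hi) with hi' | rfl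
    · rw [hle (Nat.lt_succ_iff.1 hi')]
      exact (hmxle i (Nat.lt_succ_iff.1 hi')).trans (by exact_mod_cast le_max_left mx x')
    · rw [hnew0]; exact_mod_cast le_max_right mx x'
  · -- running maximum attained
    show ∃ i, i ≤ n + 1 ∧ ((max mx x' : ℕ) : ℤ) = _
    rcases le_total mx x' with hm | hm
    · exact ⟨n + 1, le_rfl, by rw [max_eq_right hm, hnew0]⟩
    · obtain ⟨i, hi, he⟩ := hmxat
      exact ⟨i, hi.trans (Nat.le_succ n), by rw [max_eq_left hm, hle hi, he]⟩
  · -- live record visits are pending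
    intro k hk1 hk hkN hk2 hY hrec hlive
    show _ ∈ (if _ then _ else _)
    rcases Nat.lt_succ_iff_lt_or_eq.1 (Nat.lt_succ_iff.2 hk) with hk' | rfl
    · have hkn : k ≤ n := Nat.lt_succ_iff.1 hk'
      rw [hle hkn] at hY hrec hlive ⊢
      have hm : (funOf n l k 0).toNat ∈ pend :=
        hpend k hk1 hkn hkN hk2 hY (fun i hi => by have := hrec i hi; rwa [hle (hi.trans hkn)] at this)
          (fun j hj hjn => by have := hlive j hj (hjn.trans (Nat.le_succ n)); rwa [hle hjn] at this)
      have hlt : (funOf n l k 0).toNat < x' := by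
        have h := hlive (n + 1) (Nat.lt_succ_of_le hkn) le_rfl
        rw [hnew0] at h
        have hp := hpos k hk1 hkn
        exact (Int.toNat_lt (by omega)).2 h
      have hm' : (funOf n l k 0).toNat ∈ pend.filter (fun q => Nat.blt q x') := mem_filter_blt.2 ⟨hm, hlt⟩
      split_ifs
      · exact List.mem_append.2 (Or.inl hm')
      · exact hm'
    · -- the new site is itself a record visit
      rw [hnew0, Int.toNat_natCast]
      rw [hnew1] at hY
      have hd0 : d' = 0 := by omega
      have hmx : mx ≤ x' := by
        obtain ⟨i, hi, he⟩ := hmxat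
        have := hrec i (hi.trans (Nat.le_succ n))
        rw [hle hi, hnew0, ← he] at this
        exact_mod_cast this
      rw [if_pos ⟨by rw [htime]; exact hk2, hd0, hmx, by omega⟩]
      exact List.mem_append.2 (Or.inr (List.mem_singleton_self _))

/-- ★ **Soundness of a leaf**: at time `N` with the final test passed, the walk is an irreducible positive wall bridge with `V` visits.
[cite: MadrasSlade1993, Section 1.2, Definition 1.2.4; Section 4.2, Definition 4.2.1] [cite: Kesten1963SAW, Section 4] -/
theorem mem_ipwb_of_invS_final {s : St} {l : List (ℤ × ℤ)} (hI : InvS N B N s l) (hfin : final V s = true) (hN : N % 2 = 0)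
    (h1 : 1 ≤ N) : funOf N l ∈ ipwb N ∧ visits N (funOf N l) = V := by
  obtain ⟨x, d, mask, nn, v, mx, pend⟩ := s
  obtain ⟨hlen, hzero, hbw, hinj, hpos, hhp, htime, hx, hd, hdle, hmask, hvis, hmxle, hmxat, hpend⟩ := hI
  simp only at htime hx hd hdle hmask hvis hmxle hmxat hpend
  obtain ⟨hvV, hmxx, hpe⟩ := final_iff.1 hfin
  have hYN : funOf N l N 1 = 0 := by omega
  have hXN : ∀ i, i ≤ N → funOf N l i 0 ≤ funOf N l N 0 := fun i hi => by rw [← hx, ← hmxx]; exact hmxle i hi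
  have hX0 : funOf N l 0 0 = 0 := by rw [hzero]; rfl
  have hX0le : ∀ i, i ≤ N → funOf N l 0 0 ≤ funOf N l i 0 := by
    intro i hi
    rw [hX0]
    rcases Nat.eq_zero_or_pos i with rfl | hi0
    · rw [hX0]
    · exact le_trans (by norm_num) (hpos i hi0 hi)
  have hWB : IsWB N (funOf N l) := fun i hi => ⟨hX0le i hi, hXN i hi⟩
  have hBr : Zd.IsBridge N (funOf N l) := fun i hi1 hi => ⟨by rw [hX0]; exact lt_of_lt_of_le (by norm_num) (hpos i hi1 hi), hXN i hi⟩
  have hirr : ∀ k, 1 ≤ k → k < N → ¬ IsWRen N (funOf N l) k := by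
    -- a wall-renewal time would be a live record visit, hence pending
    intro k hk1 hkN hren
    obtain ⟨⟨-, hb1, hb2⟩, hk2, hY⟩ := hren
    have hm := hpend k hk1 hkN.le hkN hk2 hY
      (fun i hi => by
        rcases Nat.eq_zero_or_pos i with rfl | hi0
        · rw [hX0]; exact le_trans (by norm_num) (hpos k hk1 hkN.le)
        · exact (hb1 i hi0 hi).2)
      (fun j hj hjN => by
        have h := (hb2 (j - k) (by omega) (by omega)).1
        simp only [Nat.add_zero, show k + (j - k) = j by omega] at h
        exact h)
    rw [hpe] at hm
    exact (List.not_mem_nil hm).elim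
  exact ⟨mem_ipwb.2 ⟨mem_pwb.2 ⟨mem_wbr.2 ⟨mem_archs.2 ⟨mem_hpw.2 ⟨mem_saws_iff.2 ⟨hzero, fun i hi => funOf_of_le hi, hbw, hinj⟩,
    hhp⟩, hN, hYN⟩, hWB⟩, hBr⟩, h1, hirr⟩, by rw [← hvis, hvV]⟩

/-- ★ **Soundness of the search** (induction on the steps to go). [cite: MadrasSlade1993, Section 4.2, Definition 4.2.1] [cite: Kesten1963SAW, Section 4] -/
theorem grow_sound (hN : N % 2 = 0) (h1 : 1 ≤ N) :
    ∀ (r n : ℕ) (s : St) (l : List (ℤ × ℤ)), n + r = N → InvS N (N + 1) n s l →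
      ∀ y ∈ grow V (N + 1) r s l, y.length = N + 1 ∧ funOf N y ∈ ipwb N ∧ visits N (funOf N y) = V := by
  intro r
  induction r with
  | zero =>
    intro n s l hn hI y hy
    rw [Nat.add_zero] at hn
    subst hn
    obtain ⟨hfin, rfl⟩ := mem_grow_zero.1 hy
    exact ⟨hI.len, mem_ipwb_of_invS_final hI hfin hN h1⟩
  | succ r ih =>
    intro n s l hn hI y hy
    obtain ⟨x, d, mask, nn, v, mx, pend⟩ := s
    obtain ⟨x', d', hcand, hok, hy'⟩ := mem_grow_succ hy
    exact ih (n + 1) _ _ (by omega) (invS_advance hI (by omega) hcand hok) y hy'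

/-- ★★ **Soundness**: every list of the census is (the reversed site list of) an irreducible positive wall bridge of length `N` with `V`
surface visits. [cite: MadrasSlade1993, Section 4.2, Definition 4.2.1, (4.2.2)] [cite: Kesten1963SAW, Section 4] -/
theorem funOf_mem_ipwb_of_mem_census (hN : N % 2 = 0) (h1 : 1 ≤ N) {y : List (ℤ × ℤ)} (hy : y ∈ census N V) :
    y.length = N + 1 ∧ funOf N y ∈ ipwb N ∧ visits N (funOf N y) = V :=
  grow_sound hN h1 N 0 _ _ (Nat.zero_add N) (invS_init N (N + 1)) y hy

/-- `funOf N` is injective on the census. [cite: MadrasSlade1993, Section 1.1] -/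
theorem funOf_injOn (hN : N % 2 = 0) (h1 : 1 ≤ N) : Set.InjOn (funOf N) ↑(census N V).toFinset := by
  intro l hl l' hl' h
  simp only [Finset.mem_coe, List.mem_toFinset] at hl hl'
  have hlen := (funOf_mem_ipwb_of_mem_census hN h1 hl).1
  have hlen' := (funOf_mem_ipwb_of_mem_census hN h1 hl').1
  refine List.ext_getElem (by rw [hlen, hlen']) fun j hj hj' => ?_
  have e := congrFun h (N - j)
  rw [funOf_apply hlen (by omega), funOf_apply hlen' (by omega)] at e
  have e' := toSite_injective e
  have hj2 : N - (N - j) = j := by rw [hlen] at hj; omega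
  simpa [hj2] using e'

/-! ### §4  Completeness: every irreducible positive wall bridge with `V` visits is found -/

/-- Abscissa of a site of a walk, as a natural number. [cite: MadrasSlade1993, Section 1.1] -/
def xOf (ω : ℕ → Site 2) (k : ℕ) : ℕ := (ω k 0).toNat

/-- Depth (minus the ordinate) of a site of a walk, as a natural number. [cite: MadrasSlade1993, Section 1.1] -/
def dOf (ω : ℕ → Site 2) (k : ℕ) : ℕ := (-ω k 1).toNat

/-- The trajectory of states of a walk through the search for length `N`. [cite: MadrasSlade1993, Section 4.2, Definition 4.2.1] -/
def traj (N : ℕ) (ω : ℕ → Site 2) : ℕ → St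
  | 0 => init (N + 1)
  | n + 1 => advance (N + 1) (N - (n + 1)) (xOf ω (n + 1)) (dOf ω (n + 1)) (traj N ω n)

variable {ω : ℕ → Site 2}

/-- The unfolded membership conditions of an irreducible positive wall bridge. [cite: MadrasSlade1993, Section 1.2, Definition 1.2.4; Section 4.2, Definition 4.2.1] -/
theorem facts_of_mem_ipwb (hω : ω ∈ ipwb N) :
    ω 0 = 0 ∧ IsBW N ω ∧ Set.InjOn ω {i | i ≤ N} ∧ InHP N ω ∧ (N % 2 = 0 ∧ ω N 1 = 0) ∧ IsWB N ω ∧ Zd.IsBridge N ω ∧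
      (∀ k, 1 ≤ k → k < N → ¬ IsWRen N ω k) := by
  obtain ⟨hp, -, hirr⟩ := mem_ipwb.1 hω
  obtain ⟨hw, hbr⟩ := mem_pwb.1 hp
  obtain ⟨ha, hwb⟩ := mem_wbr.1 hw
  obtain ⟨hh, harch⟩ := mem_archs.1 ha
  obtain ⟨hs, hH⟩ := mem_hpw.1 hh
  obtain ⟨h0, -, hbw, hinj⟩ := mem_saws_iff.1 hs
  exact ⟨h0, hbw, hinj, hH, harch, hwb, hbr, hirr⟩

/-- Abscissae of a positive wall bridge are nonnegative. [cite: MadrasSlade1993, Section 1.2, Definition 1.2.4] -/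
theorem apply_zero_nonneg (hω : ω ∈ ipwb N) {i : ℕ} (hi : i ≤ N) : 0 ≤ ω i 0 := by
  obtain ⟨h0, -, -, -, -, -, hbr, -⟩ := facts_of_mem_ipwb hω
  rcases Nat.eq_zero_or_pos i with rfl | hi0
  · simp [h0]
  · have := (hbr i hi0 hi).1; simp only [h0, Pi.zero_apply] at this; exact this.le

/-- The natural abscissa is the abscissa. [cite: MadrasSlade1993, Section 1.1] -/
theorem cast_xOf (hω : ω ∈ ipwb N) {i : ℕ} (hi : i ≤ N) : (xOf ω i : ℤ) = ω i 0 :=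
  Int.toNat_of_nonneg (apply_zero_nonneg hω hi)

/-- The natural depth is minus the ordinate. [cite: MadrasSlade1993, Section 1.1] -/
theorem cast_dOf (hω : ω ∈ ipwb N) {i : ℕ} (hi : i ≤ N) : (dOf ω i : ℤ) = -ω i 1 := by
  obtain ⟨-, -, -, hH, -⟩ := facts_of_mem_ipwb hω
  exact Int.toNat_of_nonneg (by have := hH i hi; omega)

/-- The depth is at most the number of steps to go. [cite: HammersleyTorrieWhittington1982, Section 2] -/
theorem dOf_le (hω : ω ∈ ipwb N) {i : ℕ} (hi : i ≤ N) : dOf ω i ≤ N - i := by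
  have h := WCensus.natAbs_le_of_mem_archs (wbr_subset (mem_pwb.1 (ipwb_subset hω)).1) hi
  have e := cast_dOf hω hi
  omega

/-- The site of a walk from its natural coordinates. [cite: MadrasSlade1993, Section 1.1] -/
theorem site_xOf_dOf (hω : ω ∈ ipwb N) {i : ℕ} (hi : i ≤ N) : site (xOf ω i) (dOf ω i) = ofSite (ω i) := by
  simp only [site, cast_xOf hω hi, cast_dOf hω hi, neg_neg, ofSite]

/-- The completeness invariant of the trajectory: the state describes the prefix, the bitmask is contained in the visited sites, and every
pending abscissa is a live record visit. [cite: MadrasSlade1993, Section 4.2, Definition 4.2.1] -/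
structure InvC (N : ℕ) (ω : ℕ → Site 2) (n : ℕ) (s : St) : Prop where
  /-- the abscissa component [cite: MadrasSlade1993, Section 4.2, Definition 4.2.1] -/
  hx : s.1 = xOf ω n
  /-- the depth component [cite: MadrasSlade1993, Section 4.2, Definition 4.2.1] -/
  hd : s.2.1 = dOf ω n
  /-- the time component [cite: MadrasSlade1993, Section 4.2, Definition 4.2.1] -/
  time : s.2.2.2.1 = n
  /-- the bitmask is contained in the visited sites [cite: MadrasSlade1993, Section 4.2, Definition 4.2.1] -/
  mask : ∀ a b, b < N + 1 → Nat.testBit s.2.2.1 (key (N + 1) a b) = true → ∃ i, i ≤ n ∧ xOf ω i = a ∧ dOf ω i = b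
  /-- the visit counter [cite: MadrasSlade1993, Section 4.2, Definition 4.2.1] -/
  vis : s.2.2.2.2.1 = visits n ω
  /-- the running maximum bounds the abscissae [cite: MadrasSlade1993, Section 4.2, Definition 4.2.1] -/
  mxle : ∀ i, i ≤ n → ω i 0 ≤ (s.2.2.2.2.2.1 : ℤ)
  /-- the running maximum is attained [cite: MadrasSlade1993, Section 4.2, Definition 4.2.1] -/
  mxat : ∃ i, i ≤ n ∧ (s.2.2.2.2.2.1 : ℤ) = ω i 0
  /-- every pending abscissa is a live record visit [cite: MadrasSlade1993, Section 4.2, Definition 4.2.1] -/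
  pend : ∀ p ∈ s.2.2.2.2.2.2, ∃ k, 1 ≤ k ∧ k ≤ n ∧ k < N ∧ k % 2 = 0 ∧ ω k 1 = 0 ∧ (p : ℤ) = ω k 0 ∧
    (∀ i, i ≤ k → ω i 0 ≤ ω k 0) ∧ (∀ j, k < j → j ≤ n → ω k 0 < ω j 0)

/-- The invariant at time `0`. [cite: MadrasSlade1993, Section 1.1] -/
theorem invC_zero (hω : ω ∈ ipwb N) : InvC N ω 0 (traj N ω 0) := by
  obtain ⟨h0, -⟩ := facts_of_mem_ipwb hω
  have hx0 : xOf ω 0 = 0 := by simp [xOf, h0]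
  have hd0 : dOf ω 0 = 0 := by simp [dOf, h0]
  refine ⟨by simp [traj, init, hx0], by simp [traj, init, hd0], rfl, fun a b hb h => ?_, rfl,
    fun i hi => by rw [Nat.le_zero.1 hi]; simp [traj, init, h0], ⟨0, le_rfl, by simp [traj, init, h0]⟩,
    fun p hp => by simp [traj, init] at hp⟩
  simp only [traj, init, Nat.testBit_two_pow] at h
  have e := of_decide_eq_true h
  obtain ⟨ea, eb⟩ := key_inj (by omega) hb e
  exact ⟨0, le_rfl, by rw [hx0, ← ea], by rw [hd0, ← eb]⟩

/-- ★ **The invariant survives a step of the walk.** [cite: MadrasSlade1993, Section 4.2, Definition 4.2.1] -/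
theorem invC_succ (hω : ω ∈ ipwb N) {n : ℕ} {s : St} (hI : InvC N ω n s) (hn : n + 1 ≤ N) :
    InvC N ω (n + 1) (advance (N + 1) (N - (n + 1)) (xOf ω (n + 1)) (dOf ω (n + 1)) s) := by
  obtain ⟨x, d, mask, nn, v, mx, pend⟩ := s
  obtain ⟨hx, hd, htime, hmask, hvis, hmxle, hmxat, hpend⟩ := hI
  simp only at hx hd htime hmask hvis hmxle hmxat hpend
  have hX' := cast_xOf hω hn
  have hY' := cast_dOf hω hn
  rw [advance_eq]
  refine ⟨rfl, rfl, by simp [htime], fun a b hb h => ?_, ?_, fun i hi => ?_, ?_, fun p hp => ?_⟩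
  · -- bitmask
    simp only [Nat.testBit_lor, Bool.or_eq_true, Nat.testBit_two_pow] at h
    rcases h with h | h
    · obtain ⟨i, hi, hia, hib⟩ := hmask a b hb h
      exact ⟨i, hi.trans (Nat.le_succ n), hia, hib⟩
    · obtain ⟨ea, eb⟩ := key_inj (by have := dOf_le hω hn; omega) hb (of_decide_eq_true h)
      exact ⟨n + 1, le_rfl, ea, eb⟩
  · -- visits
    show v + _ = visits (n + 1) ω
    rw [visits_succ, ← hvis, htime]
    congr 1
    by_cases h0 : dOf ω (n + 1) = 0
    · have hY0 : ω (n + 1) 1 = 0 := by omega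
      simp [h0, hY0]
    · rw [if_neg (fun h => h0 h.2), if_neg (fun h => h0 (by omega))]
  · -- running maximum bounds
    show _ ≤ ((max mx (xOf ω (n + 1)) : ℕ) : ℤ)
    rcases Nat.lt_succ_iff_lt_or_eq.1 (Nat.lt_succ_iff.2 hi) with hi' | rfl
    · exact (hmxle i (Nat.lt_succ_iff.1 hi')).trans (by exact_mod_cast le_max_left mx _)
    · rw [← hX']; exact_mod_cast le_max_right mx _
  · -- running maximum attained
    show ∃ i, i ≤ n + 1 ∧ ((max mx (xOf ω (n + 1)) : ℕ) : ℤ) = _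
    rcases le_total mx (xOf ω (n + 1)) with hm | hm
    · exact ⟨n + 1, le_rfl, by rw [max_eq_right hm, hX']⟩
    · obtain ⟨i, hi, he⟩ := hmxat
      exact ⟨i, hi.trans (Nat.le_succ n), by rw [max_eq_left hm, he]⟩
  · -- pending abscissae are live record visits
    have hfilt : ∀ q, q ∈ pend.filter (fun q => Nat.blt q (xOf ω (n + 1))) →
        ∃ k, 1 ≤ k ∧ k ≤ n + 1 ∧ k < N ∧ k % 2 = 0 ∧ ω k 1 = 0 ∧ (q : ℤ) = ω k 0 ∧
          (∀ i, i ≤ k → ω i 0 ≤ ω k 0) ∧ (∀ j, k < j → j ≤ n + 1 → ω k 0 < ω j 0) := by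
      intro q hq
      obtain ⟨hq, hlt⟩ := mem_filter_blt.1 hq
      obtain ⟨k, hk1, hkn, hkN, hk2, hY, hq', hrec, hlive⟩ := hpend q hq
      refine ⟨k, hk1, hkn.trans (Nat.le_succ n), hkN, hk2, hY, hq', hrec, fun j hj hjn => ?_⟩
      rcases Nat.lt_succ_iff_lt_or_eq.1 (Nat.lt_succ_iff.2 hjn) with hj' | rfl
      · exact hlive j hj (Nat.lt_succ_iff.1 hj')
      · rw [← hq', ← hX']; exact_mod_cast hlt
    change p ∈ (if _ then _ else _) at hp
    split_ifs at hp with hc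
    · rcases List.mem_append.1 hp with hp | hp
      · exact hfilt p hp
      · rw [List.mem_singleton] at hp
        subst hp
        obtain ⟨hpar, hd0, hmx, hr⟩ := hc
        refine ⟨n + 1, Nat.succ_pos n, le_rfl, by omega, by rw [htime] at hpar; exact hpar, by omega, hX', fun i hi => ?_,
          fun j hj hjn => absurd hjn (by omega)⟩
        rcases Nat.lt_succ_iff_lt_or_eq.1 (Nat.lt_succ_iff.2 hi) with hi' | rfl
        · have h1 := hmxle i (Nat.lt_succ_iff.1 hi')
          rw [← hX']
          exact h1.trans (by exact_mod_cast hmx)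
        · exact le_rfl
    · exact hfilt p hp

/-- The invariant along the whole trajectory. [cite: MadrasSlade1993, Section 4.2, Definition 4.2.1] -/
theorem invC_traj (hω : ω ∈ ipwb N) : ∀ n, n ≤ N → InvC N ω n (traj N ω n)
  | 0, _ => invC_zero hω
  | n + 1, hn => by rw [traj]; exact invC_succ hω (invC_traj hω n (Nat.le_of_succ_le hn)) hn

/-- Visits occur at even times: between times `a ≤ b` there are at most `b/2 − a/2` of them.
[cite: BeatonBousquetMelouDeGierDuminilCopinGuttmann2014, Section 3.1 (arXiv v5 p. 8)] -/
theorem visits_le_add_div_sub_div (ω : ℕ → Site 2) {a b : ℕ} (hab : a ≤ b) : visits b ω ≤ visits a ω + (b / 2 - a / 2) := by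
  induction b with
  | zero => rw [Nat.le_zero.1 hab]; simp
  | succ b ih =>
    rcases Nat.lt_succ_iff_lt_or_eq.1 (Nat.lt_succ_iff.2 hab) with h | rfl
    · have h1 := ih (Nat.lt_succ_iff.1 h)
      rw [visits_succ]
      split_ifs with hc
      · have : (b + 1) / 2 = b / 2 + 1 := by omega
        omega
      · have : b / 2 ≤ (b + 1) / 2 := Nat.div_le_div_right (Nat.le_succ b)
        omega
    · simp

/-- A brick-wall step changes the ordinate by at most one, so from depth `d` at time `t` the ordinate stays `≤ −d + i` at time `t + i`.
[cite: HammersleyTorrieWhittington1982, Section 2] -/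
theorem apply_one_le_of_depth (hbw : IsBW N ω) {t d : ℕ} (ht : ω t 1 = -(d : ℤ)) :
    ∀ i, t + i ≤ N → ω (t + i) 1 ≤ -(d : ℤ) + i
  | 0, _ => by simp [ht]
  | i + 1, hi => by
    have h1 := apply_one_le_of_depth hbw ht i (by omega)
    have h2 := (brickWallGraph_adj_coord _ _).1 (hbw (t + i) (by omega))
    rw [show t + (i + 1) = t + i + 1 by omega]
    push_cast
    rcases h2 with ⟨-, h⟩ | ⟨-, ⟨h, -⟩ | ⟨h, -⟩⟩ <;> omega

/-- No surface visit before the depth is walked back: from depth `d ≥ 1` at time `t`, `visits (t + j) = visits t` for `j ≤ d − 1`.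
[cite: BeatonBousquetMelouDeGierDuminilCopinGuttmann2014, Section 3.1 (arXiv v5 p. 8)] -/
theorem visits_add_eq_of_depth (hbw : IsBW N ω) {t d : ℕ} (ht : ω t 1 = -(d : ℤ)) :
    ∀ j, j + 1 ≤ d → t + j ≤ N → visits (t + j) ω = visits t ω
  | 0, _, _ => rfl
  | j + 1, hj, hN => by
    have h1 := apply_one_le_of_depth hbw ht (j + 1) (by omega)
    push_cast at h1
    rw [show t + (j + 1) = t + j + 1 by omega] at h1 ⊢
    rw [visits_succ, visits_add_eq_of_depth hbw ht j (by omega) (by omega), if_neg (fun h => by omega)]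
    simp

/-- ★ **The walk's own moves are valid in the search.** [cite: MadrasSlade1993, Section 1.2, Definition 1.2.4; Section 4.2, Definition 4.2.1] -/
theorem ok_traj (hω : ω ∈ ipwb N) (hv : visits N ω = V) {n : ℕ} (hn : n + 1 ≤ N) {x d mask nn v mx : ℕ} {pend : List ℕ}
    (he : traj N ω n = (x, d, mask, nn, v, mx, pend)) :
    ok V (N + 1) (N - (n + 1)) (xOf ω (n + 1)) (dOf ω (n + 1)) (x, d, mask, nn, v, mx, pend) = true := by
  obtain ⟨h0, hbw, hinj, hH, ⟨hN2, hYN⟩, hwb, hbr, hirr⟩ := facts_of_mem_ipwb hω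
  have hI := invC_traj hω n (Nat.le_of_succ_le hn)
  rw [he] at hI
  obtain ⟨hx, hd, htime, hmask, hvis, hmxle, hmxat, hpend⟩ := hI
  simp only at hx hd htime hmask hvis hmxle hmxat hpend
  have hX' := cast_xOf hω hn
  have hY' := cast_dOf hω hn
  have hstep : visits n ω + (if (n + 1) % 2 = 0 ∧ dOf ω (n + 1) = 0 then 1 else 0) = visits (n + 1) ω := by
    rw [visits_succ]
    congr 1
    by_cases hd0 : dOf ω (n + 1) = 0
    · have : ω (n + 1) 1 = 0 := by omega
      simp [hd0, this]
    · rw [if_neg (fun h => hd0 h.2), if_neg (fun h => hd0 (by omega))]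
  refine ok_iff.2 ⟨?_, dOf_le hω hn, ?_, ?_, ?_⟩
  · have := (hbr (n + 1) (Nat.succ_pos n) hn).1
    simp only [h0, Pi.zero_apply] at this
    omega
  rotate_right
  · -- feasibility of the remaining visits
    rw [hvis, htime, hstep, show n + 1 + (N - (n + 1)) = N by omega, ← hv]
    have hdle := dOf_le hω hn
    rcases Nat.eq_zero_or_pos (dOf ω (n + 1)) with hd0 | hd0
    · rw [hd0, show max 0 1 = 1 from rfl]
      have := visits_le_add_div_sub_div ω hn
      omega
    · rw [max_eq_left hd0]
      have hY : ω (n + 1) 1 = -((dOf ω (n + 1) : ℕ) : ℤ) := by rw [hY', neg_neg]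
      have h1 := visits_add_eq_of_depth hbw hY (dOf ω (n + 1) - 1) (by omega) (by omega)
      rw [show n + 1 + (dOf ω (n + 1) - 1) = n + dOf ω (n + 1) by omega] at h1
      have h2 := visits_le_add_div_sub_div ω (show n + dOf ω (n + 1) ≤ N by omega)
      omega
  · -- the new site is unvisited
    cases hb : Nat.testBit mask (key (N + 1) (xOf ω (n + 1)) (dOf ω (n + 1)))
    · rfl
    · exfalso
      obtain ⟨i, hi, hia, hib⟩ := hmask _ _ (by have := dOf_le hω hn; omega) hb
      have hiN : i ≤ N := hi.trans (Nat.le_of_succ_le hn)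
      have heq : ω i = ω (n + 1) := by
        rw [site_two_eq_iff]
        constructor
        · rw [← cast_xOf hω hiN, ← cast_xOf hω hn, hia]
        · have e1 := cast_dOf hω hiN
          rw [hib] at e1
          omega
      have := hinj (show i ∈ {i | i ≤ N} by simp; omega) (show n + 1 ∈ {i | i ≤ N} by simpa using hn) heq
      omega
  · -- the visit budget
    rw [hvis, htime, hstep]
    split_ifs with hr
    · have : n + 1 = N := by omega
      rw [this, hv]
      omega
    · have h1 := WCensus.visits_le_visits_add (n + 1) (N - 1 - (n + 1)) ω
      rw [Nat.add_sub_cancel' (by omega : n + 1 ≤ N - 1)] at h1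
      have h2 : visits N ω = visits (N - 1) ω + 1 := by
        obtain ⟨M, rfl⟩ : ∃ M, N = M + 1 := ⟨N - 1, by omega⟩
        rw [visits_succ, if_pos ⟨hN2, hYN⟩, Nat.add_sub_cancel]
      omega

/-- ★ **The full walk passes the final test.** [cite: MadrasSlade1993, Section 4.2, Definition 4.2.1] [cite: Kesten1963SAW, Section 4] -/
theorem final_traj (hω : ω ∈ ipwb N) (hv : visits N ω = V) : final V (traj N ω N) = true := by
  obtain ⟨h0, hbw, hinj, hH, ⟨hN2, hYN⟩, hwb, hbr, hirr⟩ := facts_of_mem_ipwb hω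
  rcases he : traj N ω N with ⟨x, d, mask, nn, v, mx, pend⟩
  have hI := invC_traj hω N le_rfl
  rw [he] at hI
  obtain ⟨hx, hd, htime, hmask, hvis, hmxle, hmxat, hpend⟩ := hI
  simp only at hx hd htime hmask hvis hmxle hmxat hpend
  refine final_iff.2 ⟨by rw [hvis, hv], ?_, ?_⟩
  · obtain ⟨i, hi, hei⟩ := hmxat
    have h1 := (hwb i hi).2
    have h2 := hmxle N le_rfl
    have h3 := cast_xOf hω le_rfl
    rw [hx]
    omega
  · refine List.eq_nil_iff_forall_not_mem.2 fun p hp => ?_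
    obtain ⟨k, hk1, hkN', hkN, hk2, hY, -, hrec, hlive⟩ := hpend p hp
    refine hirr k hk1 hkN ⟨⟨hkN', fun i hi1 hi => ⟨?_, hrec i hi⟩, fun i hi1 hi => ⟨?_, ?_⟩⟩, hk2, hY⟩
    · exact (hbr i hi1 (hi.trans hkN')).1
    · simpa using hlive (k + i) (by omega) (by omega)
    · simpa [show k + (N - k) = N by omega] using (hwb (k + i) (by omega)).2

/-- ★ **Completeness of the search**: the full reversed list lies in the completion of each of its prefixes.
[cite: MadrasSlade1993, Section 4.2, Definition 4.2.1] -/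
theorem revList_mem_grow (hω : ω ∈ ipwb N) (hv : visits N ω = V) :
    ∀ r, r ≤ N → revList ω N ∈ grow V (N + 1) r (traj N ω (N - r)) (revList ω (N - r))
  | 0, _ => by rw [Nat.sub_zero]; exact mem_grow_zero.2 ⟨final_traj hω hv, rfl⟩
  | r + 1, hr => by
    obtain ⟨h0, hbw, hinj, hH, ⟨hN2, hYN⟩, hwb, hbr, hirr⟩ := facts_of_mem_ipwb hω
    set n := N - (r + 1) with hn
    have hn1 : n + 1 ≤ N := by omega
    have ih := revList_mem_grow hω hv r (Nat.le_of_succ_le hr)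
    rw [show N - r = n + 1 by omega, traj, show N - (n + 1) = r by omega, revList, ← site_xOf_dOf hω hn1] at ih
    rcases he : traj N ω n with ⟨x, d, mask, nn, v, mx, pend⟩
    rw [he] at ih
    have hok := ok_traj hω hv hn1 he
    rw [show N - (n + 1) = r by omega] at hok
    have hI := invC_traj hω n (by omega)
    rw [he] at hI
    obtain ⟨hx, hd, -, -, -, -, -, -⟩ := hI
    simp only at hx hd
    have hX := cast_xOf hω (Nat.le_of_succ_le hn1)
    have hY := cast_dOf hω (Nat.le_of_succ_le hn1)
    have hX' := cast_xOf hω hn1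
    have hY' := cast_dOf hω hn1
    rw [← hx] at hX
    rw [← hd] at hY
    have hadj := (brickWallGraph_adj_coord _ _).1 (hbw n (by omega))
    have hpos' := (hbr (n + 1) (Nat.succ_pos n) hn1).1
    simp only [h0, Pi.zero_apply] at hpos'
    rcases hadj with ⟨hh | hh, hv1⟩ | ⟨hv0, ⟨hu, hpar⟩ | ⟨hdn, hpar⟩⟩
    · -- right
      obtain ⟨e1, e2⟩ : xOf ω (n + 1) = x + 1 ∧ dOf ω (n + 1) = d := ⟨by omega, by omega⟩
      rw [e1, e2] at hok ih
      exact mem_grow_succ_of_right hok ih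
    · -- left
      obtain ⟨e1, e2⟩ : xOf ω (n + 1) = x - 1 ∧ dOf ω (n + 1) = d := ⟨by omega, by omega⟩
      rw [e1, e2] at hok ih
      exact mem_grow_succ_of_left hok ih
    · -- up
      obtain ⟨e1, e2⟩ : xOf ω (n + 1) = x ∧ dOf ω (n + 1) = d - 1 := ⟨by omega, by omega⟩
      rw [e1, e2] at hok ih
      exact mem_grow_succ_of_up (by omega) (by omega) hok ih
    · -- down
      obtain ⟨e1, e2⟩ : xOf ω (n + 1) = x ∧ dOf ω (n + 1) = d + 1 := ⟨by omega, by omega⟩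
      rw [e1, e2] at hok ih
      exact mem_grow_succ_of_down (by omega) hok ih

/-- ★★ **Completeness**: the reversed site list of an irreducible positive wall bridge of length `N` with `V` visits is in the census.
[cite: MadrasSlade1993, Section 4.2, Definition 4.2.1, (4.2.2)] [cite: Kesten1963SAW, Section 4] -/
theorem revList_mem_census (hω : ω ∈ ipwb N) (hv : visits N ω = V) : revList ω N ∈ census N V := by
  have h := revList_mem_grow hω hv N le_rfl
  obtain ⟨h0, -⟩ := facts_of_mem_ipwb hω
  have e : revList ω (N - N) = [(0, 0)] := by rw [Nat.sub_self, revList]; simp [h0, ofSite]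
  rwa [e, Nat.sub_self] at h

/-! ### §5  The census is exact -/

open Classical in
/-- ★★★ **The counting theorem**: for every even length `N ≥ 1` and every `V`, the number of irreducible positive wall bridges of length
`N` with `V` surface visits is the number of distinct lists of the census `WCount.census N V` (a closed term the kernel evaluates).
[cite: MadrasSlade1993, Section 4.2, Definition 4.2.1, (4.2.2)] [cite: Kesten1963SAW, Section 4] [cite: EntingJensen2009, Section 7.4.2, Fig. 7.10] -/
theorem card_filter_visits_ipwb_eq_census (hN : N % 2 = 0) (h1 : 1 ≤ N) :
    #((ipwb N).filter fun ω => visits N ω = V) = (census N V).toFinset.card := by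
  refine le_antisymm ?_ ?_
  · refine Finset.card_le_card_of_injOn (fun ω => revList ω N) (fun ω hω => ?_) fun ω hω ω' hω' h => ?_
    · obtain ⟨hω, hv⟩ := Finset.mem_filter.1 (Finset.mem_coe.1 hω)
      exact Finset.mem_coe.2 (List.mem_toFinset.2 (revList_mem_census hω hv))
    · have hω := (Finset.mem_filter.1 (Finset.mem_coe.1 hω)).1
      have hω' := (Finset.mem_filter.1 (Finset.mem_coe.1 hω')).1
      exact WCensus.eq_of_revList_eq (WCensus.frozen_of_mem_ipwb hω) (WCensus.frozen_of_mem_ipwb hω') h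
  · refine Finset.card_le_card_of_injOn (funOf N) (fun l hl => ?_) (funOf_injOn hN h1)
    obtain ⟨-, hmem, hv⟩ := funOf_mem_ipwb_of_mem_census hN h1 (List.mem_toFinset.1 (Finset.mem_coe.1 hl))
    exact Finset.mem_coe.2 (Finset.mem_filter.2 ⟨hmem, hv⟩)

open Classical in
/-- ★★★ **The counting theorem, length form**: `#{ω ∈ ipwb N | visits = V} = (WCount.census N V).length` (the census list has no duplicates) —
the form the kernel evaluates cheapest. [cite: MadrasSlade1993, Section 4.2, Definition 4.2.1, (4.2.2)] [cite: Kesten1963SAW, Section 4] -/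
theorem card_filter_visits_ipwb_eq_length_census (hN : N % 2 = 0) (h1 : 1 ≤ N) :
    #((ipwb N).filter fun ω => visits N ω = V) = (census N V).length := by
  rw [card_filter_visits_ipwb_eq_census hN h1, toFinset_card_census]

/-- Sanity evaluation: the engine's census of the class `(8,1)` has `38` lists — car 72's table-certified `N₈,₁ = 38`
(`card_oneVisit_ipwb_sixteen_eq_thirtyEight`) re-derived via `card_filter_visits_ipwb_eq_length_census` (`771` search nodes).
[cite: MadrasSlade1993, Section 4.2, (4.2.2)] [cite: EntingJensen2009, Section 7.4.2, Fig. 7.10] -/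
theorem length_census_sixteen_one : (census 16 1).length = 38 := by decide +kernel

/-- Sanity evaluation: the engine's census of the class `(9,2)` has `34` lists (car 72's `N₉,₂ = 34`; `2 834` search nodes).
[cite: MadrasSlade1993, Section 4.2, (4.2.2)] [cite: EntingJensen2009, Section 7.4.2, Fig. 7.10] -/
theorem length_census_eighteen_two : (census 18 2).length = 34 := by decide +kernel

/-- Sanity evaluation: the engine's census of the class `(10,3)` has `7` lists (car 72's `N₁₀,₃ = 7`; `6 416` search nodes).
[cite: MadrasSlade1993, Section 4.2, (4.2.2)] [cite: EntingJensen2009, Section 7.4.2, Fig. 7.10] -/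
theorem length_census_twenty_three : (census 20 3).length = 7 := by decide +kernel

open Classical in
/-- ★ **Agreement with car 72**: the engine's count of the class `(10,3)` is the table-certified class number `N₁₀,₃` (symbolic length).
[cite: MadrasSlade1993, Section 4.2, Definition 4.2.1, (4.2.2)] [cite: Kesten1963SAW, Section 4] -/
theorem length_census_twenty_three_eq_card_filter {m : ℕ} (hm : m = 20) :
    (census 20 3).length = #((ipwb m).filter fun ω => visits m ω = 3) := by
  rw [length_census_twenty_three, card_threeVisit_ipwb_twenty_eq_seven hm]

end WCount

end Literature.Probability.RandomPlanarGeometry.SAW.HexBW.Wall
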